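import Mathlib.LinearAlgebra.Lagrange
import Literature.Computability.Complexity.UmansEncoding
import Literature.Probability.Moments.KWiseTailBound
import HarnessLib

/-!
# Random polynomial curves: interpolation through prescribed points and `r`-wise uniformity

Literature / circuit complexity — derandomization (Umans 2003, §6.1 "reference curves"). For a
field `K`, a field extension `L` (a `K`-algebra; only its `K`-module structure is used) and `r ∈ ℕ`, the parametrised curves `t ↦ Σ_{e<r} tᵉ • c_e` of
`UmansEncoding.lean` (`UmansEnc.curvePt c`, coefficient vectors `c : Fin r → L`, degree `< r`):

* `UmansEnc.interpCurve D w` — **the curve through prescribed values** `w : D → L` on a node set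
  `D ⊆ K` with `|D| ≤ r` (coefficientwise Lagrange interpolation: `c_e = Σ_{b∈D} [Xᵉ]ℓ_b • w_b`),
  `curvePt_interpCurve` (it passes through the points; Umans: "curves `C₁, C₂` are defined to be the
  degree `(r - 1)` curves for which `C₁(b_{ij}) = v_{ij}` …");
* `UmansEnc.card_fiber_curvePt` — **equal fibres**: for `|D| ≤ r`, every prescription of values on
  `D` is met by exactly `|L|^{r - |D|}` coefficient vectors (`#fibre · |L|^{|D|} = |L|ʳ`; the
  evaluation map is `K`-linear and onto, its fibres are translates of the kernel);
* `UmansEnc.uniform_curvePt` — hence the values of a uniformly random curve of degree `< r` are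
  **`r`-wise uniform** in the sense of `KWise.Uniform` (`Probability/Moments/KWiseTailBound.lean`),
  which is what Claim 18 of Umans ("the set `{αⁱσᶜC₁(b)}` is an `r`-wise independent set of points")
  feeds into the tail inequality of Lemma 16;
* `UmansEnc.interpCurve_bijective` — for `|D| = r` the values on `D` determine the curve: `w ↦
  interpCurve D w` is a bijection `(D → L) ≃ (Fin r → L)` (used for "imagine picking `C₁` first and
  then the points on it", Claims 19–20); the same for an INDEXED family of nodes `b : ι ↪ K`
  (`UmansEnc.interpCurveI`, `curvePt_interpCurveI`, `interpCurveI_bijective`), the form in which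
  Umans' `C₁`, `C₂` are defined through the points `(b_{i,j}, v_{i,j})`.

All proved, [folklore] linear algebra (Lagrange interpolation); no named fact.

## References

* C. Umans, *Pseudo-random generators for all hardnesses*, JCSS 67 (2003), §6.1 (Claims 18–20)
  [Umans2003].
* M. Bellare, J. Rompel, *Randomness-efficient oblivious sampling*, FOCS 1994, §2 (polynomials of
  degree `< t` as `t`-wise independent families) [BellareRompel1994].
-/

noncomputable section

namespace Literature.Computability.Complexity

open Polynomial Finset
open Literature.Probability.Moments

namespace UmansEnc

variable {K L : Type*} [Field K] [DecidableEq K] [Field L] [Algebra K L] {r : ℕ}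

/-! ### Curves are linear in their coefficients -/

omit [DecidableEq K] in
/-- `curvePt` is additive in the coefficient vector. [folklore] -/
theorem curvePt_add (c c' : Fin r → L) (t : K) : curvePt (c + c') t = curvePt c t + curvePt c' t := by
  simp [curvePt, smul_add, sum_add_distrib]

omit [DecidableEq K] in
/-- `curvePt` of the zero vector is `0`. [folklore] -/
@[simp] theorem curvePt_zero (t : K) : curvePt (0 : Fin r → L) t = 0 := by simp [curvePt]

omit [DecidableEq K] in
/-- `curvePt` is compatible with subtraction. [folklore] -/
theorem curvePt_sub (c c' : Fin r → L) (t : K) : curvePt (c - c') t = curvePt c t - curvePt c' t := by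
  simp [curvePt, smul_sub, sum_sub_distrib]

/-! ### Interpolation -/

/-- **The curve through prescribed values** on the node set `D` (`|D| ≤ r`): its `e`-th coefficient
vector is `Σ_{b ∈ D} [Xᵉ]ℓ_b • w_b`, `ℓ_b` the Lagrange basis polynomial of the node `b`.
[cite: Umans2003, §6.1 ("Curves `C₁` and `C₂` are defined to be the degree `(r-1)` curves for which
`C₁(b_{i,j}) = v_{i,j}` …")] -/
def interpCurve (D : Finset K) (w : D → L) : Fin r → L :=
  fun e => ∑ b : D, ((Lagrange.basis D id (b : K)).coeff e) • w b

/-- Along the interpolating curve, the point at parameter `t` is `Σ_b ℓ_b(t) • w_b` (for `|D| ≤ r`).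
[folklore] -/
theorem curvePt_interpCurve_eq (D : Finset K) (hD : D.card ≤ r) (w : D → L) (t : K) :
    curvePt (interpCurve (r := r) D w) t = ∑ b : D, ((Lagrange.basis D id (b : K)).eval t) • w b := by
  unfold curvePt interpCurve
  simp_rw [smul_sum, smul_smul]
  rw [Finset.sum_comm]
  refine sum_congr rfl fun b _ => ?_
  rw [← sum_smul]
  congr 1
  have hdeg : (Lagrange.basis D id (b : K)).natDegree < r := by
    rw [Lagrange.natDegree_basis (v := id) (Set.injOn_id _) b.2]
    have : 1 ≤ D.card := card_pos.2 ⟨b, b.2⟩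
    omega
  rw [eval_eq_sum_range' hdeg, ← Fin.sum_univ_eq_sum_range (fun i => (Lagrange.basis D id (b : K)).coeff i * t ^ i)]
  refine sum_congr rfl fun e _ => ?_
  ring

/-- **The interpolating curve passes through the prescribed points.** [cite: Umans2003, §6.1] -/
theorem curvePt_interpCurve (D : Finset K) (hD : D.card ≤ r) (w : D → L) (b : D) :
    curvePt (interpCurve (r := r) D w) (b : K) = w b := by
  classical
  rw [curvePt_interpCurve_eq D hD w, Finset.sum_eq_single b]
  · have h1 : (Lagrange.basis D id (b : K)).eval (b : K) = 1 :=
      Lagrange.eval_basis_self (v := id) (Set.injOn_id _) b.2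
    rw [h1, one_smul]
  · intro b' _ hne
    have h0 : (Lagrange.basis D id (b' : K)).eval (b : K) = 0 :=
      Lagrange.eval_basis_of_ne (v := id) (fun h => hne (Subtype.ext h)) b.2
    rw [h0, zero_smul]
  · intro h; exact absurd (mem_univ b) h

/-! ### Interpolation through an indexed family of nodes -/

section Indexed

variable {ι : Type*} [Fintype ι] [DecidableEq ι]

/-- **The curve through prescribed values at indexed nodes**: for an injective node map
`b : ι ↪ K` (`|ι| ≤ r`) and values `w : ι → L`, the coefficient vector
`e ↦ Σ_t [Xᵉ]ℓ_t • w_t`, `ℓ_t` the Lagrange basis polynomial of the node `b t` (Umans' `C₁`, `C₂`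
through the points `(b_{i,j}, v_{i,j})`). [cite: Umans2003, §6.1] -/
def interpCurveI (b : ι ↪ K) (w : ι → L) : Fin r → L :=
  fun e => ∑ t : ι, ((Lagrange.basis univ b t).coeff e) • w t

omit [DecidableEq K] in
/-- Along the indexed interpolating curve, the point at parameter `s` is `Σ_t ℓ_t(s) • w_t`
(for `|ι| ≤ r`). [folklore] -/
theorem curvePt_interpCurveI_eq (b : ι ↪ K) (hr : Fintype.card ι ≤ r) (w : ι → L) (s : K) :
    curvePt (interpCurveI (r := r) b w) s = ∑ t : ι, ((Lagrange.basis univ b t).eval s) • w t := by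
  unfold curvePt interpCurveI
  simp_rw [smul_sum, smul_smul]
  rw [Finset.sum_comm]
  refine sum_congr rfl fun t _ => ?_
  rw [← sum_smul]
  congr 1
  have hdeg : (Lagrange.basis univ b t).natDegree < r := by
    rw [Lagrange.natDegree_basis (v := b) b.injective.injOn (mem_univ t), card_univ]
    have : 1 ≤ Fintype.card ι := Fintype.card_pos_iff.2 ⟨t⟩
    omega
  rw [eval_eq_sum_range' hdeg, ← Fin.sum_univ_eq_sum_range (fun i => (Lagrange.basis univ b t).coeff i * s ^ i)]
  refine sum_congr rfl fun e _ => ?_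
  ring

omit [DecidableEq K] in
/-- **The indexed interpolating curve passes through the prescribed points**:
`C(b_t) = w_t`. [cite: Umans2003, §6.1 ("`C₁(b_{i,j}) = v_{i,j}` for all `i, j`")] -/
theorem curvePt_interpCurveI (b : ι ↪ K) (hr : Fintype.card ι ≤ r) (w : ι → L) (t : ι) :
    curvePt (interpCurveI (r := r) b w) (b t) = w t := by
  classical
  rw [curvePt_interpCurveI_eq b hr w, Finset.sum_eq_single t]
  · have h1 : (Lagrange.basis univ b t).eval (b t) = 1 :=
      Lagrange.eval_basis_self (v := b) b.injective.injOn (mem_univ t)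
    rw [h1, one_smul]
  · intro t' _ hne
    have h0 : (Lagrange.basis univ b t').eval (b t) = 0 :=
      Lagrange.eval_basis_of_ne (v := b) hne (mem_univ t)
    rw [h0, zero_smul]
  · intro h; exact absurd (mem_univ t) h

omit [DecidableEq K] in
/-- **With `r` indexed nodes the values determine the curve**: `w ↦ interpCurveI b w` is a
bijection `(ι → L) → (Fin r → L)` when `|ι| = r`. [cite: Umans2003, §6.1 (Claims 19–20)] -/
theorem interpCurveI_bijective [Fintype L] (b : ι ↪ K) (hr : Fintype.card ι = r) :
    Function.Bijective (interpCurveI (r := r) (L := L) b) := by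
  classical
  have hinj : Function.Injective (interpCurveI (r := r) (L := L) b) := fun w w' h => by
    funext t
    rw [← curvePt_interpCurveI b hr.le w t, ← curvePt_interpCurveI b hr.le w' t, h]
  refine (Fintype.bijective_iff_injective_and_card _).2 ⟨hinj, ?_⟩
  rw [Fintype.card_pi, prod_const, card_univ, hr, Fintype.card_pi, prod_const, card_univ, Fintype.card_fin]

omit [DecidableEq K] in
/-- Every coefficient vector is the indexed interpolant of its values at `r` nodes. [folklore] -/
theorem interpCurveI_curvePt [Fintype L] (b : ι ↪ K) (hr : Fintype.card ι = r) (c : Fin r → L) :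
    interpCurveI (r := r) b (fun t => curvePt c (b t)) = c := by
  obtain ⟨w, hw⟩ := (interpCurveI_bijective (L := L) b hr).2 c
  rw [← hw]
  congr 1
  funext t
  exact curvePt_interpCurveI b hr.le w t

end Indexed

/-! ### Equal fibres and `r`-wise uniformity -/

section Count

variable [Fintype L]

/-- **Equal fibres of the evaluation map**: for `|D| ≤ r` and any values `vals : D → L`, the
coefficient vectors whose curve takes these values on `D` number `|L|ʳ / |L|^{|D|}`. (The fibre over
`vals` is the translate by `interpCurve D vals` of the fibre over `0`.) [cite: BellareRompel1994, §2] -/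
theorem card_fiber_curvePt [DecidableEq L] (D : Finset K) (hD : D.card ≤ r) (vals : D → L) :
    #{c : Fin r → L | ∀ b : D, curvePt c (b : K) = vals b} * Fintype.card L ^ D.card = Fintype.card L ^ r := by
  classical
  -- all fibres have the cardinality of the fibre over `0`
  have hfib : ∀ v : D → L, #{c : Fin r → L | ∀ b : D, curvePt c (b : K) = v b} =
      #{c : Fin r → L | ∀ b : D, curvePt c (b : K) = 0} := by
    intro v
    set c₀ := interpCurve (r := r) D v with hc₀
    have h₀ : ∀ b : D, curvePt c₀ (b : K) = v b := curvePt_interpCurve D hD v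
    refine card_bij' (fun c _ => c - c₀) (fun c _ => c + c₀) (fun c hc => ?_) (fun c hc => ?_)
      (fun c _ => sub_add_cancel c c₀) (fun c _ => add_sub_cancel_right c c₀)
    · simp only [mem_filter, mem_univ, true_and] at hc ⊢
      intro b; rw [curvePt_sub, hc b, h₀ b, sub_self]
    · simp only [mem_filter, mem_univ, true_and] at hc ⊢
      intro b; rw [curvePt_add, hc b, h₀ b, zero_add]
  -- the fibres partition the coefficient vectors
  have hsum : Fintype.card (Fin r → L) =
      ∑ v : D → L, #{c : Fin r → L | ∀ b : D, curvePt c (b : K) = v b} := by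
    rw [← card_univ, card_eq_sum_card_fiberwise (f := fun (c : Fin r → L) (b : D) => curvePt c (b : K))
      (t := univ) fun _ _ => mem_univ _]
    refine sum_congr rfl fun v _ => ?_
    congr 1; ext c; simp [funext_iff]
  simp_rw [hfib] at hsum
  have hΩ : Fintype.card (Fin r → L) = Fintype.card L ^ r := by simp
  have hDL : Fintype.card (D → L) = Fintype.card L ^ D.card := by simp
  rw [hΩ, sum_const, card_univ, hDL, smul_eq_mul] at hsum
  rw [hfib vals, hsum, mul_comm]

/-- **The values of a uniformly random curve of degree `< r` are `r`-wise uniform** (in the counting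
sense of `KWise.Uniform`: positions `K`, values `L`, samples the coefficient vectors).
[cite: Umans2003, §6.1, Claim 18 ("an `r`-wise independent set of points"); BellareRompel1994, §2] -/
theorem uniform_curvePt [Fintype K] [DecidableEq L] :
    KWise.Uniform (fun (c : Fin r → L) (b : K) => curvePt c b) r := by
  intro D hD vals
  rw [card_fiber_curvePt D hD vals, Fintype.card_pi, prod_const, card_univ, Fintype.card_fin]

/-- **With `r` nodes the values determine the curve**: `w ↦ interpCurve D w` is a bijection from
value assignments on `D` (`|D| = r`) onto the coefficient vectors. [cite: Umans2003, §6.1 (proofs of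
Claims 19–20: "imagine picking `C₁` … by first picking `C₁` to be a random degree `r − 1` curve, and
then picking the random `b`'s on this curve")] -/
theorem interpCurve_bijective [DecidableEq L] (D : Finset K) (hD : D.card = r) :
    Function.Bijective (interpCurve (r := r) (L := L) D) := by
  classical
  have hinj : Function.Injective (interpCurve (r := r) (L := L) D) := fun w w' h => by
    funext b
    rw [← curvePt_interpCurve D hD.le w b, ← curvePt_interpCurve D hD.le w' b, h]
  refine (Fintype.bijective_iff_injective_and_card _).2 ⟨hinj, ?_⟩
  rw [Fintype.card_pi, prod_const, card_univ, Fintype.card_coe, hD, Fintype.card_pi, prod_const,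
    card_univ, Fintype.card_fin]

/-- The inverse direction: every coefficient vector is the interpolant of its values on `r` nodes.
[folklore] -/
theorem interpCurve_curvePt [DecidableEq L] (D : Finset K) (hD : D.card = r) (c : Fin r → L) :
    interpCurve (r := r) D (fun b : D => curvePt c (b : K)) = c := by
  obtain ⟨w, hw⟩ := (interpCurve_bijective (L := L) D hD).2 c
  rw [← hw]
  congr 1
  funext b
  exact curvePt_interpCurve D hD.le w b

end Count

end UmansEnc

end Literature.Computability.Complexity

end
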